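import Summits.QuantumFields.BalabanUV.T4Continuum.Support.NE7AdmissibleFibreQuantitativeBase
import Summits.QuantumFields.BalabanUV.T4Continuum.Support.NE7DatumCoordinateStabiliser
import Summits.QuantumFields.BalabanUV.T4Continuum.Support.NE7MinimalActionUpperLipschitz
import Summits.QuantumFields.BalabanUV.T4Continuum.Support.NE7MinimalOrbitDatumContinuityGauge
import HarnessLib

/-!
# NE7MinimalActionLipschitz — THE MINIMAL ACTION `V ↦ A_k(V)` IS LIPSCHITZ (TWO-SIDED, IN THE `𝔲(n)` CHART COORDINATE) AT EVERY SMALL DATUM: for every `U(n)`, every `L ≥ 2`,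
# `d = 4`, over the small data, at every level `j+1` and every base datum `V₀`: `∃ C ≥ 0`, EVENTUALLY as the unitary `N`-periodic datum `V → V₀`,
# `|A_{j+1}(V) − A_{j+1}(V₀)| ≤ C·‖y(V)‖`, `y(V) = skewPR N (relLog N V₀ V)` — the LOWER bound `A(V₀) ≤ A(V) + C‖y(V)‖` (this file) joined with gen 113's upper bound
# (`NE7MinimalActionUpperLipschitz`).  ROAD-G113 §5ter's three-step recipe executed: the quantitative fibre at a MOVING base point (`NE7AdmissibleFibreQuantitativeBase`), the
# STABILISER-invariance of `‖y(·)‖` (`NE7DatumCoordinateStabiliser`), and the localisation of the minimiser over `V` near `U♯` MODULO THE STABILISER of `V₀` (Berge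
# `minimisers_upperHemicontinuous` with the open set `⋃_{ū ∈ Stab V₀} (gaugeAct u)⁻¹ 𝒩`, then gauge covariance `isMinimiser_gaugeAct` and chart decoding `NE7TorusChartDecoding`)

Cell `pub-balaban`, rung (B)+1 sub-cell t4, lineage `b2b-balaban-t4-ne7-p1` (CRUX PROVER NE7 #1 = OWNER of BINDER row NE7), generation 113.  Memo
`t4/b2b-balaban-t4-ne7-p1-g113/ROAD-G113.md` §5ter.
THE ARGUMENT (lower bound).  `U♯` the (8)∃ interior minimiser over `V₀`; `𝒩 = {X : X bondwise within δ₁ of U♯ on the period box}` (open); `𝒰 = {U : ∃ u unitary periodic with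
ū ∈ Stab(V₀) and U^{u} ∈ 𝒩}` is open and contains every minimiser over `V₀` (orbit uniqueness ✓ p810527: `U′^{u} = U♯`, and then `ū·V₀ = Q̄(U′^{u}) = Q̄(U♯) = V₀`), so by Berge
every minimiser `U` over a nearby `V` has `X := U^{u} ∈ 𝒩`, a minimiser over `V′ := ū·V` (gauge covariance) with `A(V′) = A(V)`; decoding writes `X = chart_{U♯}(Φ_X)`,
`‖Φ_X‖ ≤ 2δ₁`, and `g(Φ_X) = y(V′)` with `‖y(V′)‖ = ‖y(V)‖` (stabiliser invariance); the quantitative fibre at the base point `Φ_X` with target `V₀` gives `Φ′` with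
`chart_{U♯}(Φ′)` admissible over `V₀`, `‖Φ′ − Φ_X‖ ≤ ‖y(V)‖∕κ` and `A_W(chart Φ′) ≤ A_W(X) + (C∕κ)‖y(V)‖`; hence `A(V₀) ≤ levelAction(chart Φ′) ≤ A(V′) + C′‖y(V)‖ = A(V) + C′‖y(V)‖`.
WHAT ([folklore]; 0 def, 0 sorry; `d = 4`, every `U(n)`, every `L ≥ 2`).  **`minAct_lower_lipschitz`** (the lower bound, for every minimiser-carrying nearby datum), **`minAct_lipschitz`**:
`∃ ε₀ > 0, ∀ 0 < ε ≤ ε₀, ∀ N ≥ 1, ∃ δ_V > 0, ∀ V₀ (unitary, N-periodic, SmallField V₀ δ_V), ∀ j, ∃ C ≥ 0, ∀ᶠ V in 𝓝 V₀, V unitary ∧ N-periodic →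
(∃ U, IsMinimiser 4 (sfClass 4 L N ε) L N (j+1) V U) ∧ |minAct 4 (sfClass 4 L N ε) L N (j+1) V − minAct 4 (sfClass 4 L N ε) L N (j+1) V₀| ≤ C·‖skewPR N (relLog N V₀ V)‖`.
HONEST FRAMING (page 1): soft calculus and topology over landed kernel theorems; `C` existential, NOT uniform in `V₀`, `j`, `N`; the coordinate `‖y(V)‖` is the chart distance at `V₀`
(comparable to the bondwise distance on the period box, `NE7TorusChartDecoding.norm_skewPR_relLog_le`); nothing of Bałaban's asserted as an axiom and NOT his method (print: `U_k(V)`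
ANALYTIC in V — not claimed); finite 4-torus, small data; NOT NE7 as a spine node (dagwriter∕referees' call), NOT NE3; spine 0∕9; NOT infinite volume, NOT mass gap, NOT BetaPertH, NOT
Clay (continuum YM on T⁴ ⇐ BetaPertH ∧ nine spine estimates).
-/

set_option autoImplicit false

open scoped BigOperators Matrix Matrix.Norms.L2Operator Topology
open NormedSpace Finset Set Filter

namespace Summit.QuantumFields.BalabanUV.T4Continuum.NE7MinimalActionLipschitz

open Literature.MathematicalPhysics.QuantumFieldTheory.Balaban1983to89
open B7Prop1Explicit B7Prop2Explicit
open T4AveragingDeficitWall (IsUnitaryCfg SmallField fineAction)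
open T4AveragingDeficitWallBoundary (IsPeriodicCfg)
open AveragingDeficitTorusChart (TDir chart)
open AveragingDeficitChartCalculus (relLog relLog_self)
open AveragingDeficitTwoLevelPrep (skewSub skewPR)
open AveragingDeficitMultiLevelPrep (tower levelQ LevelSmall cavgIter)
open AveragingDeficitMultiLevelBridge (cavgIter_eq_avgIter)
open MinimalActionLevels (perWin levelAction stepWt stepWt_pos)
open MinimalActionSandwich (IsMinimiser admissible minAct)
open MinimalActionRate (sfClass)
open NE3EnergyShapes (IsUnitarySite IsPeriodicSite)
open NE7AdmissibleFibreLHC (period_succ_eq continuous_relVal tendsto_skewPR_relLog eventually_near_base)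
open NE7AdmissibleFibreQuantitativeBase (chart_fibre_quantitative)
open NE7TorusChartDecoding (chart_skewPR_relLog_eq norm_skewPR_relLog_le)
open NE7DatumCoordinateStabiliser (norm_skewPR_relLog_gaugeAct_stab)
open NE7MinimalOrbitDatumContinuity (thresholds minimisers_upperHemicontinuous)
open NE7MinimalOrbitDatumContinuityGauge (continuous_gaugeAct)
open NE7MinimalOrbitUniqueGeneric (minimal_orbit_unique_generic)
open NE7MinimalActionUpperLipschitz (minAct_upper_lipschitz)
open NE7EtaMinimiserGaugeCovariance (levelAction_gaugeAct isMinimiser_gaugeAct avgIter_gaugeAct_sfClass isUnitarySite_corner)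
open AveragingDeficitKDatum (gaugeAct_inv_gaugeAct)

noncomputable section

variable {n : Type} [Fintype n] [DecidableEq n]

set_option maxHeartbeats 800000 in
/-- **THE LOWER LIPSCHITZ BOUND OF THE MINIMAL ACTION IN THE DATUM, EVERY `U(n)`, EVERY `L ≥ 2`, `d = 4`** (argument in the file header): over the small data, at every level `j+1`
and every base datum `V₀`: `∃ C ≥ 0`, eventually as the unitary `N`-periodic datum `V → V₀`, for every minimiser `U` over `V`:
`minAct V₀ ≤ minAct V + C‖skewPR N (relLog N V₀ V)‖`. [folklore] -/
theorem minAct_lower_lipschitz [Nonempty n] {L : ℕ} (hL : 2 ≤ L) :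
    ∃ ε₀ : ℝ, 0 < ε₀ ∧ ∀ ε : ℝ, 0 < ε → ε ≤ ε₀ → ∀ (N : ℕ) [NeZero N], 1 ≤ N →
      ∃ δV : ℝ, 0 < δV ∧
        ∀ V₀ ∈ {V : Site 4 → Fin 4 → (Matrix n n ℂ)ˣ | IsUnitaryCfg V ∧ IsPeriodicCfg V (N : ℤ) ∧ SmallField V δV},
        ∀ j : ℕ, ∃ C : ℝ, 0 ≤ C ∧
          ∀ᶠ V in 𝓝 V₀, IsUnitaryCfg V → IsPeriodicCfg V (N : ℤ) →
            ∀ U : Site 4 → Fin 4 → (Matrix n n ℂ)ˣ, IsMinimiser 4 (sfClass 4 L N ε) L N (j + 1) V U →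
              minAct 4 (sfClass 4 L N ε) L N (j + 1) V₀ ≤ minAct 4 (sfClass 4 L N ε) L N (j + 1) V + C * ‖skewPR N (relLog N V₀ V)‖ := by
  haveI : NeZero L := ⟨by omega⟩
  have hL1 : 1 ≤ L := by omega
  obtain ⟨ε₁, hε₁, H⟩ := thresholds (n := n) hL
  obtain ⟨ε₂, hε₂, H2⟩ := minimisers_upperHemicontinuous (n := n) hL
  obtain ⟨ε₃, hε₃, H3⟩ := minimal_orbit_unique_generic (n := n) hL
  refine ⟨min ε₁ (min ε₂ ε₃), lt_min hε₁ (lt_min hε₂ hε₃), fun ε hε hεle N _ hN => ?_⟩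
  obtain ⟨-, -, hls, H1⟩ := H ε hε (hεle.trans (min_le_left _ _))
  obtain ⟨δ₁, hδ₁, hint₁⟩ := H1 N hN
  obtain ⟨δ₂, hδ₂, husc⟩ := H2 ε hε (hεle.trans ((min_le_right _ _).trans (min_le_left _ _))) N hN
  obtain ⟨δ₃, hδ₃, huniq⟩ := H3 ε hε (hεle.trans ((min_le_right _ _).trans (min_le_right _ _))) N hN
  refine ⟨min δ₁ (min δ₂ δ₃), lt_min hδ₁ (lt_min hδ₂ hδ₃), fun V₀ hV₀ j => ?_⟩
  obtain ⟨hV₀u, hV₀P, hV₀δ⟩ := hV₀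
  have hV₀1 : V₀ ∈ {V : Site 4 → Fin 4 → (Matrix n n ℂ)ˣ | IsUnitaryCfg V ∧ IsPeriodicCfg V (N : ℤ) ∧ SmallField V δ₁} :=
    ⟨hV₀u, hV₀P, MinimalActionRate.SmallField.mono hV₀δ (min_le_left _ _)⟩
  have hV₀2 : V₀ ∈ {V : Site 4 → Fin 4 → (Matrix n n ℂ)ˣ | IsUnitaryCfg V ∧ IsPeriodicCfg V (N : ℤ) ∧ SmallField V δ₂} :=
    ⟨hV₀u, hV₀P, MinimalActionRate.SmallField.mono hV₀δ ((min_le_right _ _).trans (min_le_left _ _))⟩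
  have hV₀3 : V₀ ∈ {V : Site 4 → Fin 4 → (Matrix n n ℂ)ˣ | IsUnitaryCfg V ∧ IsPeriodicCfg V (N : ℤ) ∧ SmallField V δ₃} :=
    ⟨hV₀u, hV₀P, MinimalActionRate.SmallField.mono hV₀δ ((min_le_right _ _).trans (min_le_right _ _))⟩
  -- the interior minimiser `U♯` over `V₀`, the period `M`
  obtain ⟨Us, hUs, a, -, haε, hUsa⟩ := hint₁ V₀ hV₀1 (j + 1)
  set M : ℕ := L * tower L N j with hMdef
  have hper : N * L ^ (j + 1) = M := by rw [hMdef]; exact period_succ_eq L N j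
  haveI : NeZero M := ⟨by rw [← hper]; exact Nat.mul_ne_zero (NeZero.ne N) (pow_ne_zero _ (by omega))⟩
  have hUsU : IsUnitaryCfg Us := hUs.mem.1.1
  have hUsP : IsPeriodicCfg Us (M : ℤ) := by have h := hUs.mem.1.2.1; rwa [hper] at h
  have hUsavg : cavgIter L (j + 1) Us = V₀ := by rw [cavgIter_eq_avgIter]; exact hUs.mem.2
  -- the quantitative fibre at a moving base point of the chart at `U♯`
  obtain ⟨κ, C, Cg, ρ₀, hκ, hC, hCg, hρ₀, hF⟩ :=
    chart_fibre_quantitative (d := 4) (n := n) hL1 hε.le (hls j) hUs.mem haε hUsa (perWin 4 (N * L ^ (j + 1)))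
  -- the level weight and the final constant
  set w : ℝ := ((stepWt 4 L)⁻¹) ^ (j + 1) with hw
  have hw0 : 0 < w := pow_pos (inv_pos.mpr (stepWt_pos (d := 4) L hL1)) _
  refine ⟨w * C / κ, by positivity, ?_⟩
  -- the neighbourhood `𝒩` of `U♯` (bondwise on the period box) and the localising open set `𝒰`
  set δ : ℝ := min (1 / 8) (ρ₀ / 4) with hδ
  have hδ0 : 0 < δ := lt_min (by norm_num) (by positivity)
  have hδ8 : δ ≤ 1 / 8 := min_le_left _ _
  have hδρ : δ ≤ ρ₀ / 4 := min_le_right _ _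
  set 𝒩 : Set (Site 4 → Fin 4 → (Matrix n n ℂ)ˣ) := {X | ∀ (r : Fin 4 → Fin M) (κ' : Fin 4),
    ‖(((Us (boxVec M r) κ')⁻¹ : (Matrix n n ℂ)ˣ) : Matrix n n ℂ) * (X (boxVec M r) κ' : Matrix n n ℂ) - 1‖ < δ} with h𝒩
  have h𝒩o : IsOpen 𝒩 := by
    have e : 𝒩 = ⋂ r : Fin 4 → Fin M, ⋂ κ' : Fin 4, {X : Site 4 → Fin 4 → (Matrix n n ℂ)ˣ |
        ‖(((Us (boxVec M r) κ')⁻¹ : (Matrix n n ℂ)ˣ) : Matrix n n ℂ) * (X (boxVec M r) κ' : Matrix n n ℂ) - 1‖ < δ} := by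
      ext X; simp only [h𝒩, mem_setOf_eq, mem_iInter]
    rw [e]
    refine isOpen_iInter_of_finite fun r => isOpen_iInter_of_finite fun κ' => ?_
    exact isOpen_lt (((continuous_relVal Us (boxVec M r) κ').sub continuous_const).norm) continuous_const
  set 𝒰 : Set (Site 4 → Fin 4 → (Matrix n n ℂ)ˣ) := {U | ∃ u : Site 4 → (Matrix n n ℂ)ˣ, IsUnitarySite u ∧
    IsPeriodicSite u ((N * L ^ (j + 1) : ℕ) : ℤ) ∧ gaugeAct (fun z : Site 4 => u (((L : ℤ) ^ (j + 1)) • z)) V₀ = V₀ ∧ gaugeAct u U ∈ 𝒩} with h𝒰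
  have h𝒰o : IsOpen 𝒰 := by
    rw [isOpen_iff_mem_nhds]
    rintro U ⟨u, hu, huP, hfix, hU𝒩⟩
    exact mem_of_superset ((h𝒩o.preimage (continuous_gaugeAct u)).mem_nhds hU𝒩) fun U' hU' => ⟨u, hu, huP, hfix, hU'⟩
  -- `𝒰` contains every minimiser over `V₀`
  have hUs𝒩 : Us ∈ 𝒩 := by
    intro r κ'
    rw [Units.inv_mul, sub_self, norm_zero]; exact hδ0
  obtain ⟨Us', -, horbit⟩ := huniq V₀ hV₀3 (j + 1)
  obtain ⟨us, hus, husP, hgs⟩ := horbit Us hUs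
  have h𝒰min : ∀ U' : Site 4 → Fin 4 → (Matrix n n ℂ)ˣ, IsMinimiser 4 (sfClass 4 L N ε) L N (j + 1) V₀ U' → U' ∈ 𝒰 := by
    intro U' hU'
    obtain ⟨u', hu', hu'P, hg'⟩ := horbit U' hU'
    -- `U′^{(u♯)⁻¹·u′} = U♯`
    set u : Site 4 → (Matrix n n ℂ)ˣ := fun z => (us z)⁻¹ * u' z with hudef
    have hu : IsUnitarySite u := fun z => (unitaryUnits (Matrix n n ℂ)).mul_mem ((unitaryUnits (Matrix n n ℂ)).inv_mem (hus z)) (hu' z)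
    have huP : IsPeriodicSite u ((N * L ^ (j + 1) : ℕ) : ℤ) := fun x i => by simp only [hudef, husP x i, hu'P x i]
    have hgU : gaugeAct u U' = Us := by
      have hmul : gaugeAct u U' = gaugeAct (fun z => (us z)⁻¹) (gaugeAct u' U') := by
        funext x μ; simp only [hudef, gaugeAct]; group
      rw [hmul, hg', ← hgs, gaugeAct_inv_gaugeAct]
    -- the corner values of `u` fix `V₀`: both `U′^{u}` and `U′` have average `V₀`
    have hfix : gaugeAct (fun z : Site 4 => u (((L : ℤ) ^ (j + 1)) • z)) V₀ = V₀ := by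
      have h := avgIter_gaugeAct_sfClass hL1 hε.le j (hls j) hU'.mem.1 hu
      rw [hgU, hUs.mem.2, hU'.mem.2] at h
      exact h.symm
    exact ⟨u, hu, huP, hfix, by rw [hgU]; exact hUs𝒩⟩
  -- Berge: the minimisers over nearby data lie in `𝒰`; the nearby data are bondwise near `V₀` with small coordinate
  have hU𝒰 := husc V₀ hV₀2 (j + 1) 𝒰 h𝒰o h𝒰min
  have hnear := eventually_near_base (d := 4) (n := n) N V₀
  have hcoord : ∀ᶠ V in 𝓝 V₀, ‖skewPR N (relLog N V₀ V)‖ < κ * ρ₀ := by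
    have h := tendsto_skewPR_relLog (d := 4) (n := n) N V₀
    have hb : Metric.ball (0 : ↥(skewSub 4 n N)) (κ * ρ₀) ∈ 𝓝 (0 : ↥(skewSub 4 n N)) := Metric.ball_mem_nhds _ (by positivity)
    have h2 : ∀ᶠ V in 𝓝 V₀, skewPR N (relLog N V₀ V) ∈ Metric.ball (0 : ↥(skewSub 4 n N)) (κ * ρ₀) := h hb
    exact h2.mono fun V hV => by simpa [dist_zero_right] using hV
  filter_upwards [hU𝒰, hnear, hcoord] with V hV𝒰 hVnear hVcoord hVu hVP U hU
  obtain ⟨u, hu, huP, hfix, hX𝒩⟩ := hV𝒰 hVu hVP U hU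
  -- `X := U^{u}`, a minimiser over `V′ := ū·V` with the same minimal action
  set ub : Site 4 → (Matrix n n ℂ)ˣ := fun z : Site 4 => u (((L : ℤ) ^ (j + 1)) • z) with hub
  have hXmin : IsMinimiser 4 (sfClass 4 L N ε) L N (j + 1) (gaugeAct ub V) (gaugeAct u U) := isMinimiser_gaugeAct hL1 hε.le j (hls j) hU hu huP
  have hmV : minAct 4 (sfClass 4 L N ε) L N (j + 1) (gaugeAct ub V) = minAct 4 (sfClass 4 L N ε) L N (j + 1) V := by
    rw [hXmin.minAct_eq, hU.minAct_eq, levelAction_gaugeAct]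
  have hXu : IsUnitaryCfg (gaugeAct u U) := hXmin.mem.1.1
  have hXP : IsPeriodicCfg (gaugeAct u U) (M : ℤ) := by have h := hXmin.mem.1.2.1; rwa [hper] at h
  have hXavg : cavgIter L (j + 1) (gaugeAct u U) = gaugeAct ub V := by rw [cavgIter_eq_avgIter]; exact hXmin.mem.2
  -- decoding: `X = chart_{U♯}(Φ_X)` with `‖Φ_X‖ ≤ 2δ ≤ ρ₀`
  have hXnear : ∀ (r : Fin 4 → Fin M) (κ' : Fin 4),
      ‖(((Us (boxVec M r) κ')⁻¹ : (Matrix n n ℂ)ˣ) : Matrix n n ℂ) * ((gaugeAct u U (boxVec M r) κ' : (Matrix n n ℂ)ˣ) : Matrix n n ℂ) - 1‖ ≤ δ := fun r κ' => (hX𝒩 r κ').le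
  set ΦX : ↥(skewSub 4 n M) := skewPR M (relLog M Us (gaugeAct u U)) with hΦX
  have hdec : chart (ContinuousLinearMap.id ℝ (Matrix n n ℂ)) M Us (ΦX : TDir 4 n M) = gaugeAct u U :=
    chart_skewPR_relLog_eq hUsU hXu hUsP hXP fun r κ' => (hXnear r κ').trans (by linarith)
  have hΦXn : ‖ΦX‖ ≤ 2 * δ := norm_skewPR_relLog_le hδ0.le (by linarith) hXnear
  have hΦXρ : ‖ΦX‖ ≤ ρ₀ := by linarith
  -- `g(Φ_X) = y(V′)` and `‖y(V′)‖ = ‖y(V)‖` (stabiliser invariance)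
  have hg : levelQ L N j Us (chart (ContinuousLinearMap.id ℝ (Matrix n n ℂ)) M Us (ΦX : TDir 4 n M)) = skewPR N (relLog N V₀ (gaugeAct ub V)) := by
    show skewPR N (relLog N (cavgIter L (j + 1) Us) (cavgIter L (j + 1) (chart (ContinuousLinearMap.id ℝ (Matrix n n ℂ)) M Us (ΦX : TDir 4 n M))))
      = skewPR N (relLog N V₀ (gaugeAct ub V))
    rw [hdec, hUsavg, hXavg]
  have hyeq : ‖skewPR N (relLog N V₀ (gaugeAct ub V))‖ = ‖skewPR N (relLog N V₀ V)‖ :=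
    norm_skewPR_relLog_gaugeAct_stab (fun z => isUnitarySite_corner hu _ z) hfix hVnear
  -- the quantitative fibre at the base point `Φ_X`, target `V₀`
  obtain ⟨-, hfib⟩ := hF ΦX hΦXρ
  have hy0 : skewPR N (relLog N V₀ V₀) = 0 := by rw [relLog_self, map_zero]
  have hV₀near : ∀ (r : Fin 4 → Fin N) (κ' : Fin 4),
      ‖(((V₀ (boxVec N r) κ')⁻¹ : (Matrix n n ℂ)ˣ) : Matrix n n ℂ) * (V₀ (boxVec N r) κ' : Matrix n n ℂ) - 1‖ ≤ 1 / 4 := by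
    intro r κ'; rw [Units.inv_mul, sub_self, norm_zero]; norm_num
  have hdist : ‖skewPR N (relLog N V₀ V₀) - levelQ L N j Us (chart (ContinuousLinearMap.id ℝ (Matrix n n ℂ)) M Us (ΦX : TDir 4 n M))‖ = ‖skewPR N (relLog N V₀ V)‖ := by
    rw [hy0, hg, zero_sub, norm_neg, hyeq]
  obtain ⟨Φ', hΦ'd, hΦ'adm, hΦ'act⟩ := hfib V₀ hV₀u hV₀P hV₀near (by rw [hdist]; exact hVcoord.le)
  rw [hdist] at hΦ'd
  -- the comparison of actions
  have h1 : minAct 4 (sfClass 4 L N ε) L N (j + 1) V₀ ≤ levelAction 4 L N (j + 1) (chart (ContinuousLinearMap.id ℝ (Matrix n n ℂ)) M Us (Φ' : TDir 4 n M)) := by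
    rw [hUs.minAct_eq]; exact hUs.le _ hΦ'adm
  have h2 : fineAction (chart (ContinuousLinearMap.id ℝ (Matrix n n ℂ)) M Us (Φ' : TDir 4 n M)) (perWin 4 (N * L ^ (j + 1)))
      ≤ fineAction (gaugeAct u U) (perWin 4 (N * L ^ (j + 1))) + C * (‖skewPR N (relLog N V₀ V)‖ / κ) := by
    have h := (abs_sub_le_iff.mp hΦ'act).1
    rw [hdec] at h
    have h3 : C * ‖Φ' - ΦX‖ ≤ C * (‖skewPR N (relLog N V₀ V)‖ / κ) := mul_le_mul_of_nonneg_left hΦ'd hC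
    linarith
  have h4 : levelAction 4 L N (j + 1) (chart (ContinuousLinearMap.id ℝ (Matrix n n ℂ)) M Us (Φ' : TDir 4 n M))
      ≤ levelAction 4 L N (j + 1) (gaugeAct u U) + w * C / κ * ‖skewPR N (relLog N V₀ V)‖ := by
    unfold levelAction
    rw [← hw]
    have h5 := mul_le_mul_of_nonneg_left h2 hw0.le
    have e : w * (fineAction (gaugeAct u U) (perWin 4 (N * L ^ (j + 1))) + C * (‖skewPR N (relLog N V₀ V)‖ / κ))
        = w * fineAction (gaugeAct u U) (perWin 4 (N * L ^ (j + 1))) + w * C / κ * ‖skewPR N (relLog N V₀ V)‖ := by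
      field_simp
    linarith
  have h6 : levelAction 4 L N (j + 1) (gaugeAct u U) = minAct 4 (sfClass 4 L N ε) L N (j + 1) V := by
    rw [← hmV, hXmin.minAct_eq]
  linarith

/-- **THE MINIMAL ACTION IS LIPSCHITZ IN THE DATUM AT EVERY SMALL DATUM (TWO-SIDED), EVERY `U(n)`, EVERY `L ≥ 2`, `d = 4`**: over the small data, at every level `j+1` and every base datum
`V₀`: `∃ C ≥ 0`, eventually as the unitary `N`-periodic datum `V → V₀`: a minimiser over `V` exists and `|minAct V − minAct V₀| ≤ C‖skewPR N (relLog N V₀ V)‖`. [folklore] -/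
theorem minAct_lipschitz [Nonempty n] {L : ℕ} (hL : 2 ≤ L) :
    ∃ ε₀ : ℝ, 0 < ε₀ ∧ ∀ ε : ℝ, 0 < ε → ε ≤ ε₀ → ∀ (N : ℕ) [NeZero N], 1 ≤ N →
      ∃ δV : ℝ, 0 < δV ∧
        ∀ V₀ ∈ {V : Site 4 → Fin 4 → (Matrix n n ℂ)ˣ | IsUnitaryCfg V ∧ IsPeriodicCfg V (N : ℤ) ∧ SmallField V δV},
        ∀ j : ℕ, ∃ C : ℝ, 0 ≤ C ∧
          ∀ᶠ V in 𝓝 V₀, IsUnitaryCfg V → IsPeriodicCfg V (N : ℤ) →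
            (∃ U : Site 4 → Fin 4 → (Matrix n n ℂ)ˣ, IsMinimiser 4 (sfClass 4 L N ε) L N (j + 1) V U) ∧
            |minAct 4 (sfClass 4 L N ε) L N (j + 1) V - minAct 4 (sfClass 4 L N ε) L N (j + 1) V₀| ≤ C * ‖skewPR N (relLog N V₀ V)‖ := by
  obtain ⟨ε₁, hε₁, H1⟩ := minAct_upper_lipschitz (n := n) hL
  obtain ⟨ε₂, hε₂, H2⟩ := minAct_lower_lipschitz (n := n) hL
  refine ⟨min ε₁ ε₂, lt_min hε₁ hε₂, fun ε hε hεle N _ hN => ?_⟩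
  obtain ⟨δ₁, hδ₁, K1⟩ := H1 ε hε (hεle.trans (min_le_left _ _)) N hN
  obtain ⟨δ₂, hδ₂, K2⟩ := H2 ε hε (hεle.trans (min_le_right _ _)) N hN
  refine ⟨min δ₁ δ₂, lt_min hδ₁ hδ₂, fun V₀ hV₀ j => ?_⟩
  obtain ⟨hV₀u, hV₀P, hV₀δ⟩ := hV₀
  obtain ⟨C₁, hC₁, E1⟩ := K1 V₀ ⟨hV₀u, hV₀P, MinimalActionRate.SmallField.mono hV₀δ (min_le_left _ _)⟩ j
  obtain ⟨C₂, hC₂, E2⟩ := K2 V₀ ⟨hV₀u, hV₀P, MinimalActionRate.SmallField.mono hV₀δ (min_le_right _ _)⟩ j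
  refine ⟨max C₁ C₂, le_max_of_le_left hC₁, ?_⟩
  filter_upwards [E1, E2] with V hV1 hV2 hVu hVP
  obtain ⟨hex, hup⟩ := hV1 hVu hVP
  obtain ⟨U, hU⟩ := hex
  have hlow := hV2 hVu hVP U hU
  have hn : 0 ≤ ‖skewPR N (relLog N V₀ V)‖ := norm_nonneg _
  have hm1 : C₁ * ‖skewPR N (relLog N V₀ V)‖ ≤ max C₁ C₂ * ‖skewPR N (relLog N V₀ V)‖ := mul_le_mul_of_nonneg_right (le_max_left _ _) hn
  have hm2 : C₂ * ‖skewPR N (relLog N V₀ V)‖ ≤ max C₁ C₂ * ‖skewPR N (relLog N V₀ V)‖ := mul_le_mul_of_nonneg_right (le_max_right _ _) hn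
  refine ⟨⟨U, hU⟩, abs_sub_le_iff.mpr ⟨by linarith, by linarith⟩⟩

end

end Summit.QuantumFields.BalabanUV.T4Continuum.NE7MinimalActionLipschitz
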